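import Summits.BirchSwinnertonDyer.BirchSwinnertonDyer.Theorems.ClassRecordThreeCartanCuspRowGhost
import Summits.BirchSwinnertonDyer.BirchSwinnertonDyer.Theorems.ClassRecordThreeCartanOnePlaceDegreeLawAtThreeCMRankRealForm
import HarnessLib

/-!
# The cuspidal row of `GL₂(𝔽_q)`, IV: the pinned row with its witness, `Σ_{T_η} χ_W = |T_η|`, and THE FIXED LINE `W^{T_η} = ℂ·u` of a cuspidal irreducible — realform §P.1

Lift-only port (cell bsd-stepL, SUMMON key `ghostlift`, director-bsd (837) «(κ2) GHOSTLIFT: GO NOW» 2026-08-31; lift by tam3-p1 g43) of §P.1 (source lines 2132–2333, `section RealformFGT`) of the crux-ideate workfile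
`Summits/BirchSwinnertonDyer/BirchSwinnertonDyer/Cruxes/CartanOnePlaceDegreeLawAtThree/Lines/realform.lean` (lineage `cruxidea-stmt-BirchSwinnertonDyer-24801-1`, generation 29, commit 91f4f181dd15, sha256-16 989f1973431c01d3, 2699 l.; farm rc 0, sorries 5 = its §4 stubs, none of which is lifted; referee FULL BATTERY PASS `VERDICT-REALFORM-G29-g94.md`, §O ≡ generation 28's `Lines/cusprow.lean` §O byte-identical, referee `VERDICT-CUSPROW-G28-g93.md`).
AUTHORS OF THE BYTES: cruxidea-24801 generation 29 (`realform`, §P.1). Declarations, statements and proofs below are token-identical to the source; the only edits are the namespace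
(`…Cruxes.CartanOnePlaceDegreeLawAtThree.Realform` ↦ `…Theorems.CartanDoubleCoset`, shared with the `ClassRecordThreeCartanSupply*` lift modules), the imports ∕ `open`s ∕
section preamble each module needs, and one-line docstrings added where the source had none. Nothing is re-stated, weakened or re-proved.

CONTENT (finite group theory of `G = GL₂(𝔽_q)`, `q` odd prime). `exists_character_eq_cuspRow`: an irreducible `W` with a non-zero `T_η`-fixed vector and no non-zero
`N`-fixed vector has `χ_W = χ_{Ind_{ZN} ψ} − χ_{Ind_{T_η} ν}` for some `ψ` and some character `ν` of `T_η` trivial on the scalars and `≠ 1` (§O.6's counting, keeping its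
witness); `sum_trace_torus_eq_card`: hence `Σ_{t ∈ T_η} χ_W(t) = |T_η|`; `fixedLine_of_cuspidal`: by the tree's rank-by-trace `CMRank.exists_eq_smul_of_trace_sum_eq_card`, the
`T_η`-fixed vectors of such a `W ∋ u` form the LINE `ℂ·u` — multiplicity one of the trivial character of the non-split torus in a cuspidal representation, by counting alone.
MODULE OF RECORD of the (k2a) chain `…CuspRowInduced` → `…CuspRowNormOne` → `…CuspRowGhost` → this file (the 400-line cap splits realform's §O ∕ §P.1 into four); the registry
file `Lines/jacquet.lean` rev 11 imports THIS module (and `…ClassRecordThreeCartanRealForm`) and consumes `fixedLine_of_cuspidal` ∕ `rationalCuspidalGhost` by name.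

HONEST: a `--supports stmt-BirchSwinnertonDyer-24801 --as helper` module of PROVED finite-group theory ∕ lattice bookkeeping; it closes NO registered stub and NO leaf of
24801 — the five stubs of registry `Lines/jacquet.lean` rev 10.1 ((JV) · (NCB) · (CV♭) · (DS) ∧ (JLᶜ) · (MO1ᴾ)) stand, the registry is untouched by this module, no count moves
(1∕12 · 0∕12), nothing about NUM ∕ NUM♮ ∕ 24801 ∕ 32276 ∕ 19109 is proved for any curve; BSD is proved for no curve.
-/

set_option linter.dupNamespace false  -- `Summit.BirchSwinnertonDyer.BirchSwinnertonDyer.…` (summit = problem), as every file of this directory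
set_option autoImplicit false

noncomputable section

open scoped Classical MatrixGroups
open Matrix

namespace Summit.BirchSwinnertonDyer.BirchSwinnertonDyer.Theorems.CartanDoubleCoset

open Summit.BirchSwinnertonDyer.BirchSwinnertonDyer.Theorems
open Summit.BirchSwinnertonDyer.BirchSwinnertonDyer.Theorems.CartanDegree (HasRatEigenvalue)
open Summit.BirchSwinnertonDyer.BirchSwinnertonDyer.Theorems.CartanTorusCubeCut (torusSubgroup mem_torusSubgroup lin linGL
  linGL_coe lin_comm torusSubgroup_isCyclic card_torusSubgroup)
open Summit.BirchSwinnertonDyer.BirchSwinnertonDyer.Theorems.CartanCover (splitGen mem_splitTorus_iff)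
open Summit.BirchSwinnertonDyer.BirchSwinnertonDyer.Theorems.CartanCover.Charext.InertHecke (upperUnip lowerUnip coe_upperUnip
  coe_lowerUnip upperUnip_mul upperUnip_zero exists_unip_factorization)
open Summit.BirchSwinnertonDyer.BirchSwinnertonDyer.Theorems.CartanCover
open Summit.BirchSwinnertonDyer.BirchSwinnertonDyer.Theorems.CartanTorusCubeCut
open Summit.BirchSwinnertonDyer.BirchSwinnertonDyer.Theorems.CartanCover.CMRank

section RealformFGT

open Representation (IntertwiningMap)
open Summit.BirchSwinnertonDyer.BirchSwinnertonDyer.Theorems.CartanTorusCubeCut (G Mat)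
open Summit.BirchSwinnertonDyer.BirchSwinnertonDyer.Theorems.CartanSupply.Monomial
open Summit.BirchSwinnertonDyer.BirchSwinnertonDyer.Theorems.CartanSupply.VirtualCharacter (exists_irreducible_of_virtual_normOne
  sum_char_mul_char_inv)

variable {q : ℕ} [Fact q.Prime]

/-! ### §P.1 THE PINNED ROW, RETURNED: `χ_W = χ(Ind_{ZN} ψ) − χ(Ind_{T_η} ν)` with `ν|_Z = 1`, `ν ≠ 1` (§O.6's counting, keeping its witness), hence
`Σ_{T_η} χ_W = |T_η|` and — by rank-by-trace — the `T_η`-fixed vectors of a cuspidal irreducible `W ∋ u ≠ 0` (`u` `T_η`-fixed) form the LINE `ℂ·u` -/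

/-- **THE CUSPIDAL ROW WITH ITS WITNESS** (`q` odd): an irreducible `W` with a non-zero `T_η`-fixed vector and no non-zero `N`-fixed vector has character
`χ_W = χ_{Ind_{ZN} ψ} − χ_{Ind_{T_η} ν}` for some `ψ` and some character `ν` of `T_η`, TRIVIAL on the scalars and `≠ 1` (§O.6 verbatim up to the pinning). -/
theorem exists_character_eq_cuspRow (hq2 : q ≠ 2) (eta : Mat q) (hη : ¬ HasRatEigenvalue eta)
    (W : Type) [AddCommGroup W] [Module ℂ W] [Module.Finite ℂ W] (ρ : Representation ℂ (G q) W)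
    (hirr : ∀ W' : Submodule ℂ W, (∀ g : G q, ∀ w ∈ W', ρ g w ∈ W') → W' = ⊥ ∨ W' = ⊤)
    (hfix : ∃ u : W, u ≠ 0 ∧ ∀ t ∈ torusSubgroup eta, ρ t u = u)
    (hcusp : ∀ w : W, (∀ y : ZMod q, ρ (upperUnip y) w = w) → w = 0) :
    ∃ (ψ : AddChar (ZMod q) ℂ) (ν : torusSubgroup eta →* ℂ),
      (∀ x : torusSubgroup eta, CartanDegree.IsScalarMat ((x : G q) : Mat q) → ν x = 1) ∧ ν ≠ 1 ∧
      ∀ g : G q, ρ.character g = (monRep (znSub q) (znChar ψ)).character g - (monRep (torusSubgroup eta) ν).character g := by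
  have hpr := (Fact.out : q.Prime)
  have hq1 : 0 < q - 1 := Nat.sub_pos_of_lt hpr.one_lt
  obtain ⟨u, hu0, hu⟩ := hfix
  have hZ : ∀ (a : (ZMod q)ˣ) (w : W), ρ (Charext.scalarGL a) w = w := scalar_trivial ρ hirr hu0 hu
  have hN : Fintype.card (torusSubgroup eta) = (q - 1) * (q + 1) := card_torusSubgroup hη
  have hNpos : 0 < Fintype.card (torusSubgroup eta) := Fintype.card_pos
  -- the two counts
  have ha := sum_hom_torus_eq ρ hη
  have hb := sum_hom_zn_eq ρ hZ
  have ha0 := hom_torus_zero_pos ρ hη hu0 hu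
  have hb0 := hom_zn_zero ρ hcusp
  -- `j₀` maximising `b`, `m := b_{j₀}`: `dim W ≤ (q - 1)·m`, so `m ≥ 1`, `j₀ ≠ 0`
  obtain ⟨j₀, -, hj₀⟩ := Finset.exists_max_image (Finset.univ : Finset (ZMod q))
    (fun j => Module.finrank ℂ (IntertwiningMap (lineRep (znChar ((ψq (q := q)).mulShift j))) (res ρ (znSub q)))) Finset.univ_nonempty
  set m := Module.finrank ℂ (IntertwiningMap (lineRep (znChar ((ψq (q := q)).mulShift j₀))) (res ρ (znSub q))) with hm
  have hWle : Module.finrank ℂ W ≤ (q - 1) * m := by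
    rw [← hb, ← Finset.add_sum_erase _ _ (Finset.mem_univ (0 : ZMod q)), hb0, zero_add]
    refine (Finset.sum_le_card_nsmul _ _ m fun j _ => hj₀ j (Finset.mem_univ j)).trans ?_
    rw [Finset.card_erase_of_mem (Finset.mem_univ _), Finset.card_univ, ZMod.card, smul_eq_mul]
  have hWpos : 0 < Module.finrank ℂ W := Module.finrank_pos_iff_exists_ne_zero.2 ⟨u, hu0⟩
  have hm0 : 0 < m := by
    rcases Nat.eq_zero_or_pos m with h | h
    · rw [h, mul_zero] at hWle; omega
    · exact h
  have hj₀0 : j₀ ≠ 0 := by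
    rintro rfl
    rw [hm, hb0] at hm0
    exact lt_irrefl 0 hm0
  have hψ : (ψq (q := q)).mulShift j₀ ≠ 1 := ψq_isPrimitive hj₀0
  -- the regular exponents `R := {j' ∈ [1, q] : 2 j' ≠ q + 1}` (at least `q - 1` of them), `ν_{j'} := χ_{(q-1) j'}` is trivial on `Z`
  have hRcard : q - 1 ≤ ((Finset.Icc 1 q).filter (fun j' => 2 * j' ≠ q + 1)).card := by
    have h1 := Finset.card_filter_add_card_filter_not (s := Finset.Icc 1 q) (fun j' => 2 * j' ≠ q + 1)
    rw [Nat.card_Icc] at h1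
    have h2 : ((Finset.Icc 1 q).filter (fun j' => ¬ (2 * j' ≠ q + 1))).card ≤ 1 :=
      Finset.card_le_one.2 fun x hx y hy => by
        rw [Finset.mem_filter, Finset.mem_Icc] at hx hy
        omega
    omega
  set R : Finset ℕ := (Finset.Icc 1 q).filter (fun j' => 2 * j' ≠ q + 1) with hR
  -- some regular `ν_{j'}` has `a_{ν_{j'}} ≠ m`
  have hex : ∃ j' ∈ R, Module.finrank ℂ (IntertwiningMap (lineRep (chi hη ((q - 1) * j'))) (res ρ (torusSubgroup eta))) ≠ m := by
    by_contra hall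
    push Not at hall
    have h0notin : (0 : ℕ) ∉ R.image (fun j' => (q - 1) * j') := by
      intro h
      obtain ⟨j', hj', h0⟩ := Finset.mem_image.1 h
      have := (Finset.mem_Icc.1 (Finset.mem_filter.1 hj').1).1
      rcases Nat.mul_eq_zero.1 h0 with h | h <;> omega
    have hinj : ∀ x ∈ R, ∀ y ∈ R, (q - 1) * x = (q - 1) * y → x = y := fun x _ y _ h => Nat.eq_of_mul_eq_mul_left hq1 h
    have hsub : insert 0 (R.image (fun j' => (q - 1) * j')) ⊆ Finset.range (Fintype.card (torusSubgroup eta)) := by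
      intro j hj
      rw [Finset.mem_range, hN]
      rcases Finset.mem_insert.1 hj with rfl | hj
      · exact Nat.mul_pos hq1 (Nat.succ_pos q)
      · obtain ⟨j', hj', rfl⟩ := Finset.mem_image.1 hj
        have := (Finset.mem_Icc.1 (Finset.mem_filter.1 hj').1).2
        exact Nat.mul_lt_mul_of_pos_left (by omega) hq1
    have hsum : Module.finrank ℂ (IntertwiningMap (lineRep (chi hη 0)) (res ρ (torusSubgroup eta))) + R.card * m ≤ Module.finrank ℂ W := by
      calc Module.finrank ℂ (IntertwiningMap (lineRep (chi hη 0)) (res ρ (torusSubgroup eta))) + R.card * m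
          = Module.finrank ℂ (IntertwiningMap (lineRep (chi hη 0)) (res ρ (torusSubgroup eta))) +
              ∑ j' ∈ R, Module.finrank ℂ (IntertwiningMap (lineRep (chi hη ((q - 1) * j'))) (res ρ (torusSubgroup eta))) := by
            rw [Finset.sum_const_nat hall]
        _ = ∑ j ∈ insert 0 (R.image (fun j' => (q - 1) * j')),
              Module.finrank ℂ (IntertwiningMap (lineRep (chi hη j)) (res ρ (torusSubgroup eta))) := by
            rw [Finset.sum_insert h0notin, Finset.sum_image hinj]
        _ ≤ _ := Finset.sum_le_sum_of_subset hsub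
        _ = Module.finrank ℂ W := ha
    have hmul := Nat.mul_le_mul_right m hRcard
    omega
  obtain ⟨j', hj'R, hne⟩ := hex
  have hj'1 : 1 ≤ j' ∧ j' ≤ q := Finset.mem_Icc.1 (Finset.mem_filter.1 hj'R).1
  have hj'2 : 2 * j' ≠ q + 1 := (Finset.mem_filter.1 hj'R).2
  set ν : torusSubgroup eta →* ℂ := chi hη ((q - 1) * j') with hν
  have hZν : ∀ x : torusSubgroup eta, CartanDegree.IsScalarMat ((x : G q) : Mat q) → ν x = 1 := chi_scalar hη j'
  -- `ξ := rootT^(q-1)` is a primitive `(q+1)`-th root of unity and `ν(gen) = ξ^{j'} =: x` with `x ≠ 1`, `x² ≠ 1`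
  have hroot : IsPrimitiveRoot ((rootT eta : ℂˣ) : ℂ) (Fintype.card (torusSubgroup eta)) := IsPrimitiveRoot.coe_units_iff.2 (rootT_spec eta)
  have hξ : IsPrimitiveRoot (((rootT eta : ℂˣ) : ℂ) ^ (q - 1)) (q + 1) := hroot.pow hNpos hN
  set x : ℂ := (((rootT eta : ℂˣ) : ℂ) ^ (q - 1)) ^ j' with hx
  have hνgen : ν (gen (torusSubgroup_isCyclic hη)) = x := by rw [hν, chi_apply, faith_gen, pow_mul]
  have hx1 : x ≠ 1 := by
    intro h
    have hd := (hξ.pow_eq_one_iff_dvd j').1 h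
    have := Nat.le_of_dvd (by omega) hd
    omega
  have hx2 : x ^ 2 ≠ 1 := by
    intro h
    rw [hx, ← pow_mul] at h
    obtain ⟨k, hk⟩ := (hξ.pow_eq_one_iff_dvd (j' * 2)).1 h
    rcases Nat.lt_or_ge k 2 with hk2 | hk2
    · interval_cases k <;> omega
    · have : (q + 1) * 2 ≤ (q + 1) * k := Nat.mul_le_mul_left _ hk2
      omega
  -- `W ≅ U_ν`
  obtain ⟨U, _, _, _, ρU, hUirr, hχU⟩ := exists_irreducible_cuspRow hq2 hη hψ ν hZν ⟨gen (torusSubgroup_isCyclic hη), by rw [hνgen]; exact hx2⟩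
  have hpair : ∑ g : G q, ρ.character g * ρU.character g⁻¹ ≠ 0 := by
    have hrw : ∀ g : G q, ρ.character g * ρU.character g⁻¹ =
        ρ.character g * (monRep (znSub q) (znChar ((ψq (q := q)).mulShift j₀))).character g⁻¹ -
          ρ.character g * (monRep (torusSubgroup eta) ν).character g⁻¹ := by
      intro g; rw [hχU, mul_sub]
    simp_rw [hrw]
    rw [Finset.sum_sub_distrib, frobenius_reciprocity, frobenius_reciprocity, ← mul_sub]
    refine mul_ne_zero (by exact_mod_cast Fintype.card_ne_zero) (sub_ne_zero.2 ?_)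
    exact_mod_cast hne.symm
  have hchar := char_eq_of_pairing_ne_zero ρU ρ hUirr hirr hpair
  refine ⟨(ψq (q := q)).mulShift j₀, ν, hZν, fun h1 => hx1 ?_, fun g => by rw [hchar g, hχU g]⟩
  rw [← hνgen, h1, MonoidHom.one_apply]

/-- **`Σ_{t ∈ T_η} χ_W(t) = |T_η|`** for such a `W` (`q` odd): on the `q − 1` scalars `χ_A = q² − 1`, `χ_{B_ν} = q(q − 1)`; off the scalars `χ_A = 0` and
`χ_{B_ν}(t) = ν(t) + ν(t)⁻¹` sums to `−2(q − 1)` (`Σ_{T_η} ν = 0`, `ν ≠ 1`); total `(q − 1)(q² − 1) − q(q − 1)² + 2(q − 1) = (q − 1)(q + 1)`. -/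
theorem sum_trace_torus_eq_card (hq2 : q ≠ 2) (eta : Mat q) (hη : ¬ HasRatEigenvalue eta)
    (W : Type) [AddCommGroup W] [Module ℂ W] [Module.Finite ℂ W] (ρ : Representation ℂ (G q) W)
    (hirr : ∀ W' : Submodule ℂ W, (∀ g : G q, ∀ w ∈ W', ρ g w ∈ W') → W' = ⊥ ∨ W' = ⊤)
    (hfix : ∃ u : W, u ≠ 0 ∧ ∀ t ∈ torusSubgroup eta, ρ t u = u)
    (hcusp : ∀ w : W, (∀ y : ZMod q, ρ (upperUnip y) w = w) → w = 0) :
    ∑ t : torusSubgroup eta, LinearMap.trace ℂ W (ρ (t : G q)) = Nat.card (torusSubgroup eta) := by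
  obtain ⟨ψ, ν, hZ, hν1, hchar⟩ := exists_character_eq_cuspRow hq2 eta hη W ρ hirr hfix hcusp
  have hpr := (Fact.out : q.Prime)
  have hcastq1 : (((q - 1 : ℕ)) : ℂ) = (q : ℂ) - 1 := by rw [Nat.cast_sub hpr.one_lt.le, Nat.cast_one]
  have hZcard : (((Finset.univ.filter (fun t : torusSubgroup eta => CartanDegree.IsScalarMat ((t : G q) : Mat q))).card : ℕ) : ℂ) =
      (q : ℂ) - 1 := by rw [card_scalar_torus hη, hcastq1]
  have hνZ : ∀ t ∈ Finset.univ.filter (fun t : torusSubgroup eta => CartanDegree.IsScalarMat ((t : G q) : Mat q)), ν t = 1 :=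
    fun t ht => hZ t (Finset.mem_filter.1 ht).2
  have hνZ' : ∀ t ∈ Finset.univ.filter (fun t : torusSubgroup eta => CartanDegree.IsScalarMat ((t : G q) : Mat q)), ν t⁻¹ = 1 :=
    fun t ht => hZ t⁻¹ (by rw [Subgroup.coe_inv]; exact (CartanSupply.isScalarMat_coe_inv_iff (t : G q)).2 (Finset.mem_filter.1 ht).2)
  -- `Σ_{T_η ∖ Z} ν = −(q − 1) = Σ_{T_η ∖ Z} ν⁻¹`
  have eν : (∑ t ∈ Finset.univ.filter (fun t : torusSubgroup eta => CartanDegree.IsScalarMat ((t : G q) : Mat q)), ν t) +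
      ∑ t ∈ Finset.univ.filter (fun t : torusSubgroup eta => ¬ CartanDegree.IsScalarMat ((t : G q) : Mat q)), ν t = 0 := by
    rw [Finset.sum_filter_add_sum_filter_not]
    exact sum_hom_units_eq_zero ν hν1
  have eν' : (∑ t ∈ Finset.univ.filter (fun t : torusSubgroup eta => CartanDegree.IsScalarMat ((t : G q) : Mat q)), ν t⁻¹) +
      ∑ t ∈ Finset.univ.filter (fun t : torusSubgroup eta => ¬ CartanDegree.IsScalarMat ((t : G q) : Mat q)), ν t⁻¹ = 0 := by
    rw [Finset.sum_filter_add_sum_filter_not]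
    calc ∑ t : torusSubgroup eta, ν t⁻¹ = ∑ t : torusSubgroup eta, ν t :=
          Fintype.sum_equiv (Equiv.inv (torusSubgroup eta)) _ _ (fun t => by rw [Equiv.inv_apply])
      _ = 0 := sum_hom_units_eq_zero ν hν1
  rw [Finset.sum_congr rfl hνZ, Finset.sum_const, nsmul_eq_mul, mul_one, hZcard] at eν
  rw [Finset.sum_congr rfl hνZ', Finset.sum_const, nsmul_eq_mul, mul_one, hZcard] at eν'
  -- `Σ_{T_η} χ_A = (q − 1)(q² − 1)`
  have hA : ∑ t : torusSubgroup eta, (monRep (znSub q) (znChar ψ)).character (t : G q) = ((q : ℂ) - 1) * ((q : ℂ) ^ 2 - 1) := by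
    rw [← Finset.sum_filter_add_sum_filter_not Finset.univ (fun t : torusSubgroup eta => CartanDegree.IsScalarMat ((t : G q) : Mat q))]
    have h1 : ∑ t ∈ Finset.univ.filter (fun t : torusSubgroup eta => CartanDegree.IsScalarMat ((t : G q) : Mat q)),
        (monRep (znSub q) (znChar ψ)).character (t : G q) =
        ∑ t ∈ Finset.univ.filter (fun t : torusSubgroup eta => CartanDegree.IsScalarMat ((t : G q) : Mat q)), ((q : ℂ) ^ 2 - 1) :=
      Finset.sum_congr rfl fun t ht => valA_scalar ψ (Finset.mem_filter.1 ht).2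
    have h2 : ∑ t ∈ Finset.univ.filter (fun t : torusSubgroup eta => ¬ CartanDegree.IsScalarMat ((t : G q) : Mat q)),
        (monRep (znSub q) (znChar ψ)).character (t : G q) = 0 :=
      Finset.sum_eq_zero fun t ht => valA_torus hq2 hη ψ t.2 (Finset.mem_filter.1 ht).2
    rw [h1, h2, add_zero, Finset.sum_const, nsmul_eq_mul, hZcard]
  -- `Σ_{T_η} χ_{B_ν} = q(q − 1)² − 2(q − 1)`
  have hB : ∑ t : torusSubgroup eta, (monRep (torusSubgroup eta) ν).character (t : G q) =
      ((q : ℂ) - 1) * ((q : ℂ) * ((q : ℂ) - 1)) - 2 * ((q : ℂ) - 1) := by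
    rw [← Finset.sum_filter_add_sum_filter_not Finset.univ (fun t : torusSubgroup eta => CartanDegree.IsScalarMat ((t : G q) : Mat q))]
    have h1 : ∑ t ∈ Finset.univ.filter (fun t : torusSubgroup eta => CartanDegree.IsScalarMat ((t : G q) : Mat q)),
        (monRep (torusSubgroup eta) ν).character (t : G q) =
        ∑ t ∈ Finset.univ.filter (fun t : torusSubgroup eta => CartanDegree.IsScalarMat ((t : G q) : Mat q)), ((q : ℂ) * ((q : ℂ) - 1)) :=
      Finset.sum_congr rfl fun t ht => valB_scalar hη ν hZ (Finset.mem_filter.1 ht).2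
    have h2 : ∑ t ∈ Finset.univ.filter (fun t : torusSubgroup eta => ¬ CartanDegree.IsScalarMat ((t : G q) : Mat q)),
        (monRep (torusSubgroup eta) ν).character (t : G q) =
        ∑ t ∈ Finset.univ.filter (fun t : torusSubgroup eta => ¬ CartanDegree.IsScalarMat ((t : G q) : Mat q)), (ν t + ν t⁻¹) :=
      Finset.sum_congr rfl fun t ht => by
        rw [valB_torus hq2 hη ν hZ t.2 (Finset.mem_filter.1 ht).2, map_inv, Subtype.coe_eta]
    rw [h1, h2, Finset.sum_const, nsmul_eq_mul, hZcard, Finset.sum_add_distrib]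
    linear_combination eν + eν'
  have hterm : ∀ t : torusSubgroup eta, LinearMap.trace ℂ W (ρ (t : G q)) =
      (monRep (znSub q) (znChar ψ)).character (t : G q) - (monRep (torusSubgroup eta) ν).character (t : G q) := fun t => hchar (t : G q)
  rw [Fintype.sum_congr _ _ hterm, Finset.sum_sub_distrib, hA, hB, card_torus_cast hη]
  ring

/-- **THE FIXED LINE `W^{T_η} = ℂ·u`** of a cuspidal irreducible `W` (`q` odd; rank by trace `CMRank.exists_eq_smul_of_trace_sum_eq_card` on the sum above):
the multiplicity-one of the trivial character of the non-split torus in a cuspidal representation, by counting alone. [cite: Bump1997, Prop. 4.1.5 p. 407] -/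
theorem fixedLine_of_cuspidal (hq2 : q ≠ 2) (eta : Mat q) (hη : ¬ HasRatEigenvalue eta)
    (W : Type) [AddCommGroup W] [Module ℂ W] [Module.Finite ℂ W] (ρ : Representation ℂ (G q) W)
    (hirr : ∀ W' : Submodule ℂ W, (∀ g : G q, ∀ w ∈ W', ρ g w ∈ W') → W' = ⊥ ∨ W' = ⊤)
    {u : W} (hu0 : u ≠ 0) (hu : ∀ t ∈ torusSubgroup eta, ρ t u = u)
    (hcusp : ∀ w : W, (∀ y : ZMod q, ρ (upperUnip y) w = w) → w = 0)
    (v : W) (hv : ∀ t ∈ torusSubgroup eta, ρ t v = v) : ∃ c : ℂ, v = c • u :=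
  exists_eq_smul_of_trace_sum_eq_card ρ (torusSubgroup eta) (sum_trace_torus_eq_card hq2 eta hη W ρ hirr ⟨u, hu0, hu⟩ hcusp) hu0 hu v hv

end RealformFGT

end Summit.BirchSwinnertonDyer.BirchSwinnertonDyer.Theorems.CartanDoubleCoset

end
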